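import Mathlib
import Summits.PneNP.PneNP.Theorems.SfmBlConnectedPairsRect

/-!
# Transfer of pair-connectivity along label maps — line «sfm-bl» (stmt-PneNP-20523), M5 dictionary

FRONTIER F-N1c; nothing here bears on P vs NP.

The parametric pipeline theorem `SfmBl.cutCertified_of_pipeline` speaks of connectivity of a pair `(W₁, W₂)` in
the bipartite graph `bipGraph E` on `α ⊕ β` (clause `hsp` in the `Sum.elim` spelling, the families `𝒲 s` through
`IsConnectedPair`); the machine (`SfmBlMachineWalks`) speaks of connectivity of a SET OF LABELS in ONE graph on
labels (`pieceGraph`).  This file is the encoding-free dictionary between the two: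
* `setOf_sumElim_mem_eq` / `isConnectedPair_iff_sumElim` — the `Sum.elim` spelling of `hsp` is `IsConnectedPair`;
* `connected_induce_iff_of_injOn` — induced connectivity is invariant under a map injective on the set and
  preserving adjacency on it (any two simple graphs);
* `isConnectedPair_iff_connected_labels` — for label maps `fα : α → V`, `fβ : β → V` injective on the sides, with
  disjoint images, no same-side adjacency in `G`, and `E i k ↔ G.Adj (fα i) (fβ k)` on `W₁ × W₂`:
  `IsConnectedPair E W₁ W₂ ↔ (G.induce ↑(W₁.image fα ∪ W₂.image fβ)).Connected`;
* `card_image_union_image` — the label set has `|W₁| + |W₂|` elements (size bookkeeping for `hsp` / `cands`).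
Definition-free.
-/

namespace Summit.PneNP.PneNP.Theorems.SfmBl

open Finset

variable {α β : Type*}

/-- The `Sum.elim` spelling of the vertex set of a pair is the coercion of `W₁.disjSum W₂`. -/
theorem setOf_sumElim_mem_eq (W₁ : Finset α) (W₂ : Finset β) :
    {x : α ⊕ β | Sum.elim (· ∈ W₁) (· ∈ W₂) x} = ((W₁.disjSum W₂ : Finset (α ⊕ β)) : Set (α ⊕ β)) := by
  ext x
  cases x with
  | inl a => simp
  | inr b => simp

/-- `IsConnectedPair E W₁ W₂` is the connectivity hypothesis of clause `hsp` of `cutCertified_of_pipeline`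
(the `Sum.elim` spelling). -/
theorem isConnectedPair_iff_sumElim (E : α → β → Prop) (W₁ : Finset α) (W₂ : Finset β) :
    IsConnectedPair E W₁ W₂
      ↔ ((bipGraph E).induce {x : α ⊕ β | Sum.elim (· ∈ W₁) (· ∈ W₂) x}).Connected := by
  rw [setOf_sumElim_mem_eq]; rfl

/-- INDUCED CONNECTIVITY IS INVARIANT under a map injective on the set and preserving adjacency on it. -/
theorem connected_induce_iff_of_injOn {V V' : Type*} (G : SimpleGraph V) (G' : SimpleGraph V') (f : V → V')
    (S : Set V) (hinj : Set.InjOn f S) (hadj : ∀ x ∈ S, ∀ y ∈ S, (G.Adj x y ↔ G'.Adj (f x) (f y))) :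
    (G.induce S).Connected ↔ (G'.induce (f '' S)).Connected := by
  classical
  let φ : S ≃ f '' S := Equiv.Set.imageOfInjOn f S hinj
  have iso : G.induce S ≃g G'.induce (f '' S) :=
    { toEquiv := φ
      map_rel_iff' := by
        intro a b
        simp only [SimpleGraph.induce_adj]
        show G'.Adj (f a.1) (f b.1) ↔ G.Adj a.1 b.1
        exact (hadj a.1 a.2 b.1 b.2).symm }
  exact iso.connected_iff

/-- PAIR-CONNECTIVITY THROUGH LABELS.  Label maps `fα`, `fβ` into the vertex type of ONE graph `G`, injective on
the sides, with separated images, no same-side adjacency, and `E i k ↔ G.Adj (fα i) (fβ k)` on `W₁ × W₂`: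
the pair is connected for `E` iff its label set is connected in `G`. -/
theorem isConnectedPair_iff_connected_labels {V : Type*} [DecidableEq V] (E : α → β → Prop)
    (G : SimpleGraph V) (fα : α → V) (fβ : β → V) (W₁ : Finset α) (W₂ : Finset β)
    (hα : Set.InjOn fα W₁) (hβ : Set.InjOn fβ W₂) (hsep : ∀ i ∈ W₁, ∀ k ∈ W₂, fα i ≠ fβ k)
    (hLL : ∀ i ∈ W₁, ∀ i' ∈ W₁, ¬ G.Adj (fα i) (fα i'))
    (hRR : ∀ k ∈ W₂, ∀ k' ∈ W₂, ¬ G.Adj (fβ k) (fβ k'))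
    (hLR : ∀ i ∈ W₁, ∀ k ∈ W₂, (E i k ↔ G.Adj (fα i) (fβ k))) :
    IsConnectedPair E W₁ W₂ ↔ (G.induce ((W₁.image fα ∪ W₂.image fβ : Finset V) : Set V)).Connected := by
  classical
  set S : Set (α ⊕ β) := ((W₁.disjSum W₂ : Finset (α ⊕ β)) : Set (α ⊕ β)) with hS
  have memL : ∀ i, (Sum.inl i : α ⊕ β) ∈ S ↔ i ∈ W₁ := fun i => by
    simp only [hS, Finset.mem_coe, Finset.inl_mem_disjSum]
  have memR : ∀ k, (Sum.inr k : α ⊕ β) ∈ S ↔ k ∈ W₂ := fun k => by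
    simp only [hS, Finset.mem_coe, Finset.inr_mem_disjSum]
  have hinj : Set.InjOn (Sum.elim fα fβ) S := by
    intro x hx y hy hxy
    cases x with
    | inl i =>
      cases y with
      | inl i' => exact congrArg Sum.inl (hα ((memL i).1 hx) ((memL i').1 hy) hxy)
      | inr k => exact absurd hxy (hsep i ((memL i).1 hx) k ((memR k).1 hy))
    | inr k =>
      cases y with
      | inl i => exact absurd hxy.symm (hsep i ((memL i).1 hy) k ((memR k).1 hx))
      | inr k' => exact congrArg Sum.inr (hβ ((memR k).1 hx) ((memR k').1 hy) hxy)
  have hadj : ∀ x ∈ S, ∀ y ∈ S,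
      ((bipGraph E).Adj x y ↔ G.Adj (Sum.elim fα fβ x) (Sum.elim fα fβ y)) := by
    intro x hx y hy
    cases x with
    | inl i =>
      cases y with
      | inl i' =>
        show (bipGraph E).Adj (Sum.inl i) (Sum.inl i') ↔ G.Adj (fα i) (fα i')
        exact ⟨fun h => (bipGraph_not_adj_inl_inl E i i' h).elim,
          fun h => (hLL i ((memL i).1 hx) i' ((memL i').1 hy) h).elim⟩
      | inr k =>
        show (bipGraph E).Adj (Sum.inl i) (Sum.inr k) ↔ G.Adj (fα i) (fβ k)
        exact (bipGraph_adj_inl_inr E i k).trans (hLR i ((memL i).1 hx) k ((memR k).1 hy))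
    | inr k =>
      cases y with
      | inl i =>
        show (bipGraph E).Adj (Sum.inr k) (Sum.inl i) ↔ G.Adj (fβ k) (fα i)
        exact (bipGraph_adj_inr_inl E i k).trans
          ((hLR i ((memL i).1 hy) k ((memR k).1 hx)).trans (G.adj_comm _ _))
      | inr k' =>
        show (bipGraph E).Adj (Sum.inr k) (Sum.inr k') ↔ G.Adj (fβ k) (fβ k')
        exact ⟨fun h => (bipGraph_not_adj_inr_inr E k k' h).elim,
          fun h => (hRR k ((memR k).1 hx) k' ((memR k').1 hy) h).elim⟩
  have himg : Sum.elim fα fβ '' S = ((W₁.image fα ∪ W₂.image fβ : Finset V) : Set V) := by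
    ext v
    simp only [Set.mem_image, Finset.coe_union, Finset.coe_image, Set.mem_union, Finset.mem_coe]
    constructor
    · rintro ⟨x, hx, rfl⟩
      cases x with
      | inl i => exact Or.inl ⟨i, (memL i).1 hx, rfl⟩
      | inr k => exact Or.inr ⟨k, (memR k).1 hx, rfl⟩
    · rintro (⟨i, hi, rfl⟩ | ⟨k, hk, rfl⟩)
      · exact ⟨Sum.inl i, (memL i).2 hi, rfl⟩
      · exact ⟨Sum.inr k, (memR k).2 hk, rfl⟩
  rw [← himg, ← connected_induce_iff_of_injOn (bipGraph E) G (Sum.elim fα fβ) S hinj hadj]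
  rfl

/-- SIZE BOOKKEEPING: the label set of a pair has `|W₁| + |W₂|` elements. -/
theorem card_image_union_image {V : Type*} [DecidableEq V] (fα : α → V) (fβ : β → V)
    (W₁ : Finset α) (W₂ : Finset β) (hα : Set.InjOn fα W₁) (hβ : Set.InjOn fβ W₂)
    (hsep : ∀ i ∈ W₁, ∀ k ∈ W₂, fα i ≠ fβ k) :
    (W₁.image fα ∪ W₂.image fβ).card = W₁.card + W₂.card := by
  classical
  rw [Finset.card_union_of_disjoint, Finset.card_image_of_injOn hα, Finset.card_image_of_injOn hβ]
  rw [Finset.disjoint_left]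
  intro v hv hv'
  obtain ⟨i, hi, rfl⟩ := Finset.mem_image.1 hv
  obtain ⟨k, hk, hk'⟩ := Finset.mem_image.1 hv'
  exact hsep i hi k hk hk'.symm

end Summit.PneNP.PneNP.Theorems.SfmBl
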